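/-
Copyright (c) 2026 the pub-hodgecm-mathlib formalisation cell (harness21).  Prover seat hodgecm-mathlib-K2E2-p12 (g5): Track B «K2-LIT», ENGINE E1,
h413 = stmt-HodgeConjecture-24833; «EIS-WHITTAKER-3» W3₃ (W-asm) sub-brick (U3C-c3) «THE UNIT VALUES OFF A FINITE SET S(ξ)» — the payment of ★ (U3C-b)'s letter `hW`.
-/
import Summits.HodgeConjecture.HodgeConjecture.Theorems.K2E1WhittakerLocalUnitValueInertU3      -- ★ (this seat) (U3C-c3-inert)
import Summits.HodgeConjecture.HodgeConjecture.Theorems.K2E1WhittakerLocalUnitValueSplitU3      -- ★ (this seat) (U3C-c3-split)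
import HarnessLib

/-!
# K2·E1 — `K2E1WhittakerLocalUnitValuesCofiniteU3` («EIS-WHITTAKER-3» W3₃, (W-asm) sub-brick (U3C-c3)): FOR EVERY `ξ ∈ L^×`, ★ B1's LOCAL WHITTAKER TOKEN TAKES ITS
# UNIT VALUE `W_v(ξ,z) = (1 − q_v^{−z})(1 − ε_v q_v^{−z})(1 − ε_v q_v^{−(2z−1)})` AT ALL BUT FINITELY MANY `v`, FOR ALL `z` WITH `1 < Re z` — the letter `hW` of ★ (U3C-a)∕(U3C-b)

Track B ∕ K2-LIT, crux h413 = `stmt-HodgeConjecture-24833`, route of record `HCCMUnconditional`; cell `hodgecm-mathlib`, squad K2, ENGINE E1 (campaign «EIS-WHITTAKER-3», rung W3₃).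
THEOREMS ONLY (no `def`, no instance, no notation, no `sorry`; default heartbeats); lane `--supports stmt-HodgeConjecture-24833 --as helper` (count-neutral).  ASSEMBLY of ★ (U3C-c1)
(`χ_w` has conductor exponent `0` cofinitely), ★ (U3C-c3-inert) (rotation by `cξ(1+δ)` + ★ B-inert) and ★ (U3C-c3-split) (★ B-split), with the cofinite unit conditions on
`2, δ, d, ξ, ξ·cξ, cξ(1+δ), ξ(1−δ)` (★ `eventually_valued_algebraMap_eq_one`) and unramifiedness (★ `finite_setOf_not_isUnramifiedIn`).  Consequently ★ (U3C-b)'s letter `hW` holds with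
`S ⊇ S(ξ)` FINITE and INDEPENDENT OF `z` — exactly what ★ C3₃-A (`HolomorphicContinuationTemplateCubed`) needs.
* `one_add_delta_ne_zero`, `mul_complexConj_mem`, **`eventually_localWhittaker_eq_unit`** (HEAD): `∀ ξ ≠ 0, ∀ᶠ v in cofinite, ∀ z, 1 < Re z → W_v(ξ,z) = unit_v(z)` (★ B1's token and unit
  value VERBATIM, for a family of Haar measures `ν_v`); `exists_finset_localWhittaker_eq_unit` (the same as `∃ S(ξ) : Finset, ∀ v ∉ S(ξ), …` — the shape of `hW`).
HONEST LABEL: HC_CM is proved only modulo the 7 printed citations (2 remaining named inputs: hLiu418 = `stmt-HodgeConjecture-24832`, h413 = `stmt-HodgeConjecture-24833`) until rung 0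
closes; this file asserts no named fact and closes no socket; count-neutral; unconditional.

## References
* [Rogawski1990] J. D. Rogawski, *Automorphic Representations of Unitary Groups in Three Variables* (1990): §4.5.
* [Langlands1971] R. P. Langlands, *Euler Products* (1971): §3.
* [TateThesis1967] J. Tate, *Fourier analysis in number fields and Hecke's zeta-functions* (1967): §2.2, Lemma 4.1.5.
-/

set_option autoImplicit false
set_option linter.dupNamespace false -- the mandated namespace repeats `HodgeConjecture.HodgeConjecture`

noncomputable section

open MeasureTheory NumberField IsDedekindDomain Filter
open scoped NNReal ENNReal
open Literature.NumberTheory.Automorphic Literature.NumberTheory.Automorphic.UnitaryGroup Literature.NumberTheory.GaloisRepresentations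
open Literature.NumberTheory.GaloisRepresentations.IsNonarchimedeanLocalField
open Literature.NumberTheory.GelbartRogawski1991.UnitaryDualPair.LocalSplitting (splitSqrt toPlace_surjective valued_toPlace_of_split valued_splitSqrt)
open Summit.HodgeConjecture.HodgeConjecture.Cruxes.H413.K2E1IntertwiningLocalFactorU3HeightSplit (smul_galInv_ne)
open Summit.HodgeConjecture.HodgeConjecture.Cruxes.H413.K2E1WhittakerLocalCharactersCM (eventually_hasConductorExp_zero_charComp)
open Summit.HodgeConjecture.HodgeConjecture.Cruxes.H413.K2E1WhittakerLocalRotationU3 (normAbs_eq_one_of_valued_eq_one)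
open Summit.HodgeConjecture.HodgeConjecture.Cruxes.H413.K2E1WhittakerLocalUnitValueInertU3 (localWhittaker_eq_unit_of_nonsplit)
open Summit.HodgeConjecture.HodgeConjecture.Cruxes.H413.K2E1WhittakerLocalUnitValueSplitU3 (localWhittaker_eq_unit_of_split)

namespace Summit.HodgeConjecture.HodgeConjecture.Cruxes.H413.K2E1WhittakerLocalUnitValuesCofiniteU3

variable (L : Type) [Field L] [NumberField L] [IsCMField L] {δ : L} (hcδ : IsCMField.complexConj L δ = -δ) (hδ : δ ≠ 0)
  {d : ↥(maximalRealSubfield L)} (hd : δ * δ = algebraMap ↥(maximalRealSubfield L) L d)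

include hcδ in
/-- `1 + δ ≠ 0` and `1 − δ ≠ 0` for a non-trivially skew `δ` (`cδ = −δ`: `δ = ∓1` would give `2 = 0`). [folklore] -/
theorem one_add_delta_ne_zero : 1 + δ ≠ 0 ∧ 1 - δ ≠ 0 := by
  constructor
  · intro h
    have hδ1 : δ = -1 := by linear_combination h
    have h1 := hcδ
    rw [hδ1, map_neg, map_one, neg_neg] at h1
    exact two_ne_zero (by linear_combination -h1 : (2 : L) = 0)
  · intro h
    have hδ1 : δ = 1 := by linear_combination -h
    have h1 := hcδ
    rw [hδ1, map_one] at h1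
    exact two_ne_zero (by linear_combination h1 : (2 : L) = 0)

/-- `ξ·cξ ∈ L⁺`. [folklore] -/
theorem mul_complexConj_mem (ξ : L) : ξ * IsCMField.complexConj L ξ ∈ maximalRealSubfield L := by
  rw [← IsCMField.complexConj_eq_self_iff, map_mul, IsCMField.complexConj_apply_apply, mul_comm]

variable [∀ v : HeightOneSpectrum (𝓞 ↥(maximalRealSubfield L)), MeasurableSpace (v.adicCompletion ↥(maximalRealSubfield L))] [∀ v : HeightOneSpectrum (𝓞 ↥(maximalRealSubfield L)), BorelSpace (v.adicCompletion ↥(maximalRealSubfield L))]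
  (νv : ∀ v : HeightOneSpectrum (𝓞 ↥(maximalRealSubfield L)), Measure (v.adicCompletion ↥(maximalRealSubfield L))) [∀ v, (νv v).IsAddHaarMeasure]

include hd in
/-- **FOR EVERY `ξ ∈ L^×`, THE LOCAL WHITTAKER TOKEN TAKES ITS UNIT VALUE AT ALL BUT FINITELY MANY PLACES, FOR ALL `z` WITH `1 < Re z`**:
`∀ᶠ v in cofinite, ∀ z, 1 < Re z → W_v(ξ,z) = (1 − q_v^{−z})(1 − ε_v q_v^{−z})(1 − ε_v q_v^{−(2z−1)})` (★ B1's token and unit value VERBATIM).  The exceptional set: ramified `v`, `v ∣ 2dδ`,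
the places where `χ_w` has non-zero conductor (★ (U3C-c1)), and the places where `ξ`, `ξ·cξ`, `cξ(1+δ)`, `ξ(1−δ)` are not units — finite and INDEPENDENT of `z`.
[cite: Rogawski1990, §4.5] [cite: Langlands1971, §3] [cite: TateThesis1967, Lemma 4.1.5] -/
theorem eventually_localWhittaker_eq_unit (ξ : L) (hξ : ξ ≠ 0) :
    ∀ᶠ v : HeightOneSpectrum (𝓞 ↥(maximalRealSubfield L)) in cofinite, ∀ z : ℂ, 1 < z.re →
      ((Measure.pi fun _ : Fin 3 => νv v) (integralBox ↥(maximalRealSubfield L) (Fin 3) v)).toReal⁻¹ •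
          ∫ p : Fin 3 → v.adicCompletion ↥(maximalRealSubfield L),
            ((((∏ w' : PlacesOver L v, max 1 (max ((normAbs (w'.1.adicCompletion L) (quadraticLocalEquiv L v (IsCMField.complexConj L) hcδ hδ (p 0, p 1) w') : ℝ≥0) : ℝ)
          ((normAbs (w'.1.adicCompletion L) ((toLocalRing L v (p 2) * algebraMap L (LocalRing L v) δ -
            toLocalRing L v 2⁻¹ * (quadraticLocalEquiv L v (IsCMField.complexConj L) hcδ hδ (p 0, p 1) *
              conjLocal L (IsCMField.complexConj L) v (quadraticLocalEquiv L v (IsCMField.complexConj L) hcδ hδ (p 0, p 1)))) w') : ℝ≥0) : ℝ))) : ℝ) : ℂ) ^ (-z)) *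
              (∏ w' : PlacesOver L v, (adeleAddCharAt L w'.1 (((ξ : L) : w'.1.adicCompletion L) * quadraticLocalEquiv L v (IsCMField.complexConj L) hcδ hδ (p 0, p 1) w') : ℂ))
            ∂(Measure.pi fun _ : Fin 3 => νv v) =
      (1 - (v.residueCard : ℂ) ^ (-z)) * (1 - (quadraticHeckeCharCM L).valueAtUniformizer v * (v.residueCard : ℂ) ^ (-z)) *
        (1 - (quadraticHeckeCharCM L).valueAtUniformizer v * (v.residueCard : ℂ) ^ (-(2 * z - 1))) := by
  haveI : Algebra.IsQuadraticExtension ↥(maximalRealSubfield L) L := IsCMField.isQuadraticExtension L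
  have hc1 : IsCMField.complexConj L ≠ 1 := IsCMField.complexConj_ne_one L
  obtain ⟨h1δ, h1δ'⟩ := one_add_delta_ne_zero L hcδ
  have hcξ : IsCMField.complexConj L ξ ≠ 0 := (map_ne_zero _).2 hξ
  have hd0 : d ≠ 0 := by
    rintro rfl
    rw [map_zero, mul_eq_zero, or_self] at hd
    exact hδ hd
  set n : ↥(maximalRealSubfield L) := ⟨ξ * IsCMField.complexConj L ξ, mul_complexConj_mem L ξ⟩ with hn_def
  have hn : algebraMap ↥(maximalRealSubfield L) L n = ξ * IsCMField.complexConj L ξ := rfl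
  have hn0 : n ≠ 0 := by
    intro h
    have := congrArg (algebraMap ↥(maximalRealSubfield L) L) h
    rw [hn, map_zero, mul_eq_zero] at this
    exact this.elim hξ hcξ
  have hη0 : IsCMField.complexConj L ξ * (1 + δ) ≠ 0 := mul_ne_zero hcξ h1δ
  have hcη0 : IsCMField.complexConj L (IsCMField.complexConj L ξ * (1 + δ)) ≠ 0 := (map_ne_zero _).2 hη0
  -- the cofinite conditions
  have e1 : ∀ᶠ v : HeightOneSpectrum (𝓞 ↥(maximalRealSubfield L)) in cofinite, Algebra.IsUnramifiedIn (𝓞 L) v.asIdeal :=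
    Filter.eventually_cofinite.2 (Literature.NumberTheory.GaloisRepresentations.finite_setOf_not_isUnramifiedIn ↥(maximalRealSubfield L) L)
  have e2 : ∀ᶠ v : HeightOneSpectrum (𝓞 ↥(maximalRealSubfield L)) in cofinite, Valued.v (2 : v.adicCompletion ↥(maximalRealSubfield L)) = 1 := by
    filter_upwards [eventually_valued_algebraMap_eq_one (E := ↥(maximalRealSubfield L)) (two_ne_zero : (2 : ↥(maximalRealSubfield L)) ≠ 0)] with v hv
    rwa [map_ofNat] at hv
  have e3 := eventually_forall_placesOver (F := ↥(maximalRealSubfield L)) (E := L) (eventually_valued_algebraMap_eq_one (E := L) hδ)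
  have e4 := eventually_valued_algebraMap_eq_one (E := ↥(maximalRealSubfield L)) hd0
  have e5 := eventually_hasConductorExp_zero_charComp L hcδ hδ hd
  have e6 := eventually_forall_placesOver (F := ↥(maximalRealSubfield L)) (E := L) (eventually_valued_algebraMap_eq_one (E := L) hξ)
  have e7 := eventually_forall_placesOver (F := ↥(maximalRealSubfield L)) (E := L) (eventually_valued_algebraMap_eq_one (E := L) hη0)
  have e8 := eventually_forall_placesOver (F := ↥(maximalRealSubfield L)) (E := L) (eventually_valued_algebraMap_eq_one (E := L) hcη0)
  have e9 := eventually_valued_algebraMap_eq_one (E := ↥(maximalRealSubfield L)) hn0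
  filter_upwards [e1, e2, e3, e4, e5, e6, e7, e8, e9] with v hv1 hv2 hv3 hv4 hv5 hv6 hv7 hv8 hv9 z hz
  obtain ⟨w⟩ := PlacesOver.nonempty L v
  by_cases hw : IsCMField.complexConj L • w.1 = w.1
  · -- non-split
    exact localWhittaker_eq_unit_of_nonsplit L hcδ hδ hd v w (νv v) hw hv1 hv2 (hv3 w) hv4 (hv5 w) ξ n hn hv9 hv7 hv8 hz
  · -- split
    have hw' := smul_galInv_ne L (IsCMField.complexConj L) hcδ hδ v w hw
    obtain ⟨a₁, ha₁⟩ := toPlace_surjective ↥(maximalRealSubfield L) L (IsCMField.complexConj L) hcδ hδ hd v w hw ((ξ : L) : w.1.adicCompletion L)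
    obtain ⟨a₂, ha₂⟩ := toPlace_surjective ↥(maximalRealSubfield L) L (IsCMField.complexConj L) hcδ hδ hd v (PlacesOver.galInv (IsCMField.complexConj L) w) hw'
      ((ξ : L) : (PlacesOver.galInv (IsCMField.complexConj L) w).1.adicCompletion L)
    have hu₁ : Valued.v a₁ = 1 := by rw [← valued_toPlace_of_split ↥(maximalRealSubfield L) L (IsCMField.complexConj L) v w hw a₁, ha₁]; exact hv6 w
    have hu₂ : Valued.v a₂ = 1 := by
      rw [← valued_toPlace_of_split ↥(maximalRealSubfield L) L (IsCMField.complexConj L) v (PlacesOver.galInv (IsCMField.complexConj L) w) hw' a₂, ha₂]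
      exact hv6 (PlacesOver.galInv (IsCMField.complexConj L) w)
    have hδ1 : normAbs (v.adicCompletion ↥(maximalRealSubfield L)) (splitSqrt ↥(maximalRealSubfield L) L (IsCMField.complexConj L) hcδ hδ v w) = 1 :=
      normAbs_eq_one_of_valued_eq_one v (by rw [valued_splitSqrt ↥(maximalRealSubfield L) L (IsCMField.complexConj L) hcδ hδ hd v w hw]; exact hv3 w)
    exact localWhittaker_eq_unit_of_split L hcδ hδ hd v w (νv v) hw hδ1 (normAbs_eq_one_of_valued_eq_one v hv2) (hv5 w)
      (hv5 (PlacesOver.galInv (IsCMField.complexConj L) w)) ξ a₁ a₂ ha₁ ha₂ hu₁ hu₂ hz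

include hd in
/-- **THE SAME AS A FINITE EXCEPTIONAL SET `S(ξ)`** — the shape of ★ (U3C-a)∕(U3C-b)'s letter `hW : ∀ v ∉ S, W_v(ξ,z) = unit_v(z)`, uniformly in `z` with `1 < Re z`.
[cite: Rogawski1990, §4.5] [cite: Langlands1971, §3] -/
theorem exists_finset_localWhittaker_eq_unit (ξ : L) (hξ : ξ ≠ 0) :
    ∃ S₁ : Finset (HeightOneSpectrum (𝓞 ↥(maximalRealSubfield L))), ∀ v ∉ S₁, ∀ z : ℂ, 1 < z.re →
      ((Measure.pi fun _ : Fin 3 => νv v) (integralBox ↥(maximalRealSubfield L) (Fin 3) v)).toReal⁻¹ •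
          ∫ p : Fin 3 → v.adicCompletion ↥(maximalRealSubfield L),
            ((((∏ w' : PlacesOver L v, max 1 (max ((normAbs (w'.1.adicCompletion L) (quadraticLocalEquiv L v (IsCMField.complexConj L) hcδ hδ (p 0, p 1) w') : ℝ≥0) : ℝ)
          ((normAbs (w'.1.adicCompletion L) ((toLocalRing L v (p 2) * algebraMap L (LocalRing L v) δ -
            toLocalRing L v 2⁻¹ * (quadraticLocalEquiv L v (IsCMField.complexConj L) hcδ hδ (p 0, p 1) *
              conjLocal L (IsCMField.complexConj L) v (quadraticLocalEquiv L v (IsCMField.complexConj L) hcδ hδ (p 0, p 1)))) w') : ℝ≥0) : ℝ))) : ℝ) : ℂ) ^ (-z)) *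
              (∏ w' : PlacesOver L v, (adeleAddCharAt L w'.1 (((ξ : L) : w'.1.adicCompletion L) * quadraticLocalEquiv L v (IsCMField.complexConj L) hcδ hδ (p 0, p 1) w') : ℂ))
            ∂(Measure.pi fun _ : Fin 3 => νv v) =
      (1 - (v.residueCard : ℂ) ^ (-z)) * (1 - (quadraticHeckeCharCM L).valueAtUniformizer v * (v.residueCard : ℂ) ^ (-z)) *
        (1 - (quadraticHeckeCharCM L).valueAtUniformizer v * (v.residueCard : ℂ) ^ (-(2 * z - 1))) := by
  obtain ⟨S₁, hS₁⟩ := (Filter.eventually_cofinite.1 (eventually_localWhittaker_eq_unit L hcδ hδ hd νv ξ hξ)).exists_finset_coe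
  exact ⟨S₁, fun v hv => Classical.by_contradiction fun hP => hv (Finset.mem_coe.1 ((Set.ext_iff.1 hS₁ v).2 hP))⟩

end Summit.HodgeConjecture.HodgeConjecture.Cruxes.H413.K2E1WhittakerLocalUnitValuesCofiniteU3

end
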